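import Summits.CriticalPhenomena.CardyFormulaZ2.Theorems.CardySelfDualSegmentUniformBoxCrossingStubLinkPart1
import HarnessLib

/-!
# Stub `stub_link` (crux stmt-CriticalPhenomena-5476 `UniformBoxCrossing`, line `Sketch`), part 2:
# the reflected upper square, darts of the link, examined corners

Support file of the registered stub `stub_link` (`…UniformBoxCrossingStubLink.lean`), continuing
`…UniformBoxCrossingStubLinkPart1.lean` (Bollobás–Riordan 2010, arXiv:1001.4674, §5.1 proof of
Thm. 5.3, for the corner models `M_t`):

* The reflection `upperRefl n s` swapping `S₁ = [0, n]²` and `S₂ = S₁ + (0, s)`: images of the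
  square and of its sides, `reflConfig_mem_lrCrossing_link` (`H(S₂)` for `ω` is `H(S₁)` for the
  reflected configuration), and the bookkeeping of reflected walks (`XWalk.map`).
* Darts of a walk: the first/last dart versus `endCorners` (the corners deciding the first and
  the last edge of the link), and "every other dart starts where a dart ends".
* `mem_region_of_mem_examinedCoins` — **a corner whose coins were examined by one of the two
  explorations lies in `A ∪ B`** (its zone face is a face around it, in `dualBelow ⊆ lowerHull`,
  resp. in the reflected picture); so the corners of the link strictly between its endpoints are
  unexamined, i.e. resampled from `S₂ + X` ("`P'` contains bonds only in `G`").
* The coins of the resampled configuration `brSplice n s (recolour n s m q)` at an unexamined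
  corner (those of `S₂ + X`) and at an examined junction corner (the imposed pattern, both edges
  open).
* `LinkExaminedRegionStatement` / `linkExaminedRegion_holds` — the registered glue of this file.

## References

* B. Bollobás, O. Riordan, *Percolation on self-dual polygon configurations*, Bolyai Soc. Math.
  Stud. 21 (2010) 131–217, arXiv:1001.4674, §5.1 proof of Thm. 5.3, §5.2. [BollobasRiordan2010]
-/

noncomputable section

namespace Summit.CriticalPhenomena.CardyFormulaZ2.Cruxes.UniformBoxCrossing.NonSlantLine

open SimpleGraph Finset Literature.Probability.Percolation Literature.Probability.LatticeModels

variable {n s : ℕ}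

/-! ### The reflection swapping the two squares -/

/-- Relabelling along the reflection preserves lattice configurations. [folklore] -/
theorem reflConfig_subset_edgeSet_link {ω : BondConfig (Site 2)} (h : ω ⊆ (zdGraph 2).edgeSet) :
    reflConfig n s ω ⊆ (zdGraph 2).edgeSet :=
  relabel_subset_edgeSet (upperRefl n s) h

/-- Images under the reflection (as an `Equiv`). [folklore] -/
theorem mem_image_upperRefl_toEquiv_iff (T : Set (Site 2)) (z : Site 2) :
    z ∈ (upperRefl n s).toEquiv '' T ↔ upperRefl n s z ∈ T := by
  constructor
  · rintro ⟨w, hw, rfl⟩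
    change upperRefl n s (upperRefl n s w) ∈ T
    rwa [upperRefl_upperRefl]
  · intro h
    exact ⟨upperRefl n s z, h, upperRefl_upperRefl n s z⟩

/-- The reflection maps the upper square `S₂` onto `S₁ = [0, n]²`. [folklore] -/
theorem image_upperRefl_upperSquare :
    (upperRefl n s).toEquiv '' upperSquare n s = (↑(rectangle n n) : Set (Site 2)) := by
  ext z
  have hv0 : (![0, (s : ℤ)] : Site 2) 0 = 0 := rfl
  have hv1 : (![0, (s : ℤ)] : Site 2) 1 = s := rfl
  rw [mem_image_upperRefl_toEquiv_iff, upperSquare, mem_image_add_rectangle, hv0, hv1,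
    upperRefl_apply_zero, upperRefl_apply_one, Finset.mem_coe, mem_rectangle_iff]
  omega

/-- The reflection maps the left side of `S₂` onto the left side of `S₁`. [folklore] -/
theorem image_upperRefl_leftSide :
    (upperRefl n s).toEquiv '' ((· + ![0, (s : ℤ)]) '' (↑(leftSide n n) : Set (Site 2))) =
      ↑(leftSide n n) := by
  ext z
  have hv0 : (![0, (s : ℤ)] : Site 2) 0 = 0 := rfl
  have hv1 : (![0, (s : ℤ)] : Site 2) 1 = s := rfl
  rw [mem_image_upperRefl_toEquiv_iff]
  simp only [Set.image_add_right, Set.mem_preimage, Finset.mem_coe, leftSide, Finset.mem_filter,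
    mem_rectangle_iff, Pi.add_apply, Pi.neg_apply, hv0, hv1, upperRefl_apply_zero,
    upperRefl_apply_one]
  omega

/-- The reflection maps the right side of `S₂` onto the right side of `S₁`. [folklore] -/
theorem image_upperRefl_rightSide :
    (upperRefl n s).toEquiv '' ((· + ![0, (s : ℤ)]) '' (↑(rightSide n n) : Set (Site 2))) =
      ↑(rightSide n n) := by
  ext z
  have hv0 : (![0, (s : ℤ)] : Site 2) 0 = 0 := rfl
  have hv1 : (![0, (s : ℤ)] : Site 2) 1 = s := rfl
  rw [mem_image_upperRefl_toEquiv_iff]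
  simp only [Set.image_add_right, Set.mem_preimage, Finset.mem_coe, rightSide, Finset.mem_filter,
    mem_rectangle_iff, Pi.add_apply, Pi.neg_apply, hv0, hv1, upperRefl_apply_zero,
    upperRefl_apply_one]
  omega

/-- **`H(S₂)` by reflection**: an open horizontal crossing of the upper square `S₂` is an open
horizontal crossing of `S₁ = [0, n]²` for the reflected configuration. [folklore] -/
theorem reflConfig_mem_lrCrossing_link {ω : BondConfig (Site 2)} (h : ω ∈ upperLR n s) :
    reflConfig n s ω ∈ lrCrossing n n := by
  have h' := relabel_mem_openCrossing (upperRefl n s).toEquiv h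
  rwa [image_upperRefl_upperSquare, image_upperRefl_leftSide, image_upperRefl_rightSide] at h'

/-- The reflection maps `S₁` into `S₂`. [folklore] -/
theorem upperRefl_mem_upperSquare {y : Site 2} (hy : y ∈ rectangle n n) :
    upperRefl n s y ∈ upperSquare n s := by
  rw [mem_rectangle_iff] at hy
  have hv0 : (![0, (s : ℤ)] : Site 2) 0 = 0 := rfl
  have hv1 : (![0, (s : ℤ)] : Site 2) 1 = s := rfl
  rw [upperSquare, mem_image_add_rectangle, hv0, hv1, upperRefl_apply_zero, upperRefl_apply_one]
  omega

/-- `upperRefl n s = reflY n + (0, s)`: the reflection swapping the squares is the reflection of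
`S₁` in its own axis followed by the translation onto `S₂`. [folklore] -/
theorem reflY_add_eq_upperRefl (y : Site 2) : reflY (n : ℤ) y + ![0, (s : ℤ)] = upperRefl n s y := by
  have hv0 : (![0, (s : ℤ)] : Site 2) 0 = 0 := rfl
  have hv1 : (![0, (s : ℤ)] : Site 2) 1 = s := rfl
  rw [Site.eq_iff_two]
  simp only [Pi.add_apply, reflY_apply_zero, reflY_apply_one, upperRefl_apply_zero,
    upperRefl_apply_one, hv0, hv1]
  constructor <;> ring

/-- Vertices of the image of a walk under a lattice automorphism. [folklore] -/
theorem XWalk.mem_support_map_iff {φ : zdGraph 2 ≃g zdGraph 2} {w : XWalk} {z : Site 2} :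
    z ∈ (w.map φ).walk.support ↔ ∃ y ∈ w.walk.support, φ y = z := by
  simp only [XWalk.map, Walk.support_map, List.mem_map]
  rfl

/-- Edges of the image of a walk under a lattice automorphism. [folklore] -/
theorem XWalk.mem_edges_map_iff {φ : zdGraph 2 ≃g zdGraph 2} {w : XWalk} {e : Sym2 (Site 2)} :
    e ∈ (w.map φ).walk.edges ↔ ∃ e₀ ∈ w.walk.edges, e₀.map φ = e := by
  simp only [XWalk.map, Walk.edges_map, List.mem_map]
  rfl

/-! ### Darts of a walk: the first and the last dart -/

section WalkDarts

variable {V : Type*} {G : SimpleGraph V} {u v : V}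

/-- The first dart of a walk starts at its first vertex. [folklore] -/
theorem fst_eq_of_darts_head? {p : G.Walk u v} {d : G.Dart} (h : p.darts.head? = some d) :
    d.fst = u := by
  cases p with
  | nil => simp at h
  | cons hadj p' =>
    rw [Walk.darts_cons, List.head?_cons, Option.some.injEq] at h
    subst h
    rfl

/-- Every dart of a walk other than the first starts where a dart of the walk ends. [folklore] -/
theorem darts_head?_eq_or_exists_snd_eq {p : G.Walk u v} {d : G.Dart} (hd : d ∈ p.darts) :
    p.darts.head? = some d ∨ ∃ d' ∈ p.darts, d'.snd = d.fst := by
  induction p with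
  | nil => simp at hd
  | cons hadj p' ih =>
    rename_i x y z
    rw [Walk.darts_cons, List.mem_cons] at hd
    rw [Walk.darts_cons, List.head?_cons]
    rcases hd with rfl | hd
    · exact Or.inl rfl
    · right
      rcases ih hd with hh | ⟨d', hd', he⟩
      · exact ⟨⟨(x, y), hadj⟩, List.mem_cons_self, (fst_eq_of_darts_head? hh).symm⟩
      · exact ⟨d', List.mem_cons_of_mem _ hd', he⟩

/-- The last dart of a walk ends at its last vertex. [folklore] -/
theorem snd_eq_of_darts_getLast? {p : G.Walk u v} {d : G.Dart} (h : p.darts.getLast? = some d) :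
    d.snd = v := by
  have h' : p.reverse.darts.head? = some d.symm := by
    rw [Walk.darts_reverse, List.head?_reverse, List.getLast?_map, h, Option.map_some]
  exact fst_eq_of_darts_head? h'

/-- Every dart of a walk other than the last ends where a dart of the walk starts. [folklore] -/
theorem darts_getLast?_eq_or_exists_fst_eq {p : G.Walk u v} {d : G.Dart} (hd : d ∈ p.darts) :
    p.darts.getLast? = some d ∨ ∃ d' ∈ p.darts, d'.fst = d.snd := by
  have hd' : d.symm ∈ p.reverse.darts := by
    rw [Walk.darts_reverse, List.mem_reverse, List.mem_map]
    exact ⟨d, hd, rfl⟩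
  rcases darts_head?_eq_or_exists_snd_eq hd' with h | ⟨d', hd'', he⟩
  · left
    rw [Walk.darts_reverse, List.head?_reverse, List.getLast?_map] at h
    cases hl : p.darts.getLast? with
    | none => rw [hl] at h; simp at h
    | some d₀ =>
      rw [hl, Option.map_some, Option.some.injEq] at h
      rw [← Dart.symm_symm d₀, h, Dart.symm_symm]
  · right
    rw [Walk.darts_reverse, List.mem_reverse, List.mem_map] at hd''
    obtain ⟨d₀, hd₀, rfl⟩ := hd''
    exact ⟨d₀, hd₀, he⟩

/-- A vertex of a walk is its first vertex or the end of one of its darts. [folklore] -/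
theorem eq_start_or_exists_dart_snd_eq {p : G.Walk u v} {z : V} (hz : z ∈ p.support) :
    z = u ∨ ∃ d ∈ p.darts, d.snd = z := by
  rw [← Walk.cons_map_snd_darts, List.mem_cons, List.mem_map] at hz
  exact hz

/-- A vertex of a walk is its last vertex or the start of one of its darts. [folklore] -/
theorem eq_end_or_exists_dart_fst_eq {p : G.Walk u v} {z : V} (hz : z ∈ p.support) :
    z = v ∨ ∃ d ∈ p.darts, d.fst = z := by
  rw [← Walk.map_fst_darts_append, List.mem_append, List.mem_singleton, List.mem_map] at hz
  rcases hz with h | h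
  · exact Or.inr h
  · exact Or.inl h

end WalkDarts

/-- The corner of the first edge of a walk is one of its end corners. [folklore] -/
theorem cornerOf_mem_endCorners_of_head? {q : XWalk} {d : (zdGraph 2).Dart}
    (h : q.walk.darts.head? = some d) : cornerOf d.edge ∈ endCorners q := by
  unfold endCorners
  rw [h]
  simp

/-- The corner of the last edge of a walk is one of its end corners. [folklore] -/
theorem cornerOf_mem_endCorners_of_getLast? {q : XWalk} {d : (zdGraph 2).Dart}
    (h : q.walk.darts.getLast? = some d) : cornerOf d.edge ∈ endCorners q := by
  unfold endCorners
  rw [h]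
  simp

/-- Translating the edge `{z, z + eᵢ}` by `X`. [folklore] -/
theorem cornerEdge_map_add (z X : Site 2) (i : Fin 2) :
    (Literature.Probability.Percolation.cornerEdge (z, i)).map (· + X) = Literature.Probability.Percolation.cornerEdge (z + X, i) := by
  show s(z + X, z + Pi.single i 1 + X) = s(z + X, z + X + Pi.single i 1)
  rw [add_right_comm]

/-! ### Examined corners lie in `A ∪ B` -/

/-- A corner none of whose four faces lies in `H ⊇ D` is not in the zone of `D`: the faces
bounded by the two edges of the corner `z` are faces around `z`. [folklore] -/
theorem not_mem_zone_of_forall {D H : Finset (Site 2)} (hDH : D ⊆ H) {z : Site 2}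
    (hz : ∀ g ∈ facesAt z, g ∉ H) : z ∉ zone D := by
  intro h
  obtain ⟨e, he, hez⟩ := mem_zone_iff.1 h
  simp only [belowEdges, Finset.mem_biUnion] at he
  obtain ⟨g, hgD, hge⟩ := he
  have hgH := hDH hgD
  simp only [squareEdges, Finset.mem_insert, Finset.mem_singleton] at hge
  rcases hge with rfl | rfl | rfl | rfl
  · rw [show cornerOf s(g, g + Pi.single 0 1) = g from cornerOf_cornerEdge (g, 0)] at hez
    subst hez
    exact hz g (mem_facesAt_iff'.2 (Or.inl rfl)) hgH
  · rw [show cornerOf s(g, g + Pi.single 1 1) = g from cornerOf_cornerEdge (g, 1)] at hez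
    subst hez
    exact hz g (mem_facesAt_iff'.2 (Or.inl rfl)) hgH
  · rw [show cornerOf s(g + Pi.single 1 1, g + Pi.single 1 1 + Pi.single 0 1) = g + Pi.single 1 1 from
      cornerOf_cornerEdge (g + Pi.single 1 1, 0)] at hez
    subst hez
    exact hz g (mem_facesAt_iff'.2 (Or.inr (Or.inr (Or.inl rfl)))) hgH
  · rw [show cornerOf s(g + Pi.single 0 1, g + Pi.single 0 1 + Pi.single 1 1) = g + Pi.single 0 1 from
      cornerOf_cornerEdge (g + Pi.single 0 1, 1)] at hez
    subst hez
    exact hz g (mem_facesAt_iff'.2 (Or.inr (Or.inl rfl))) hgH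

/-- **An examined corner lies in `A ∪ B`.** If a coin of the corner `z` is examined by the lower
exploration of `S₁` or by the upper exploration of `S₂` (i.e. `z` is in the zone of `dualBelow` or
of `dualAbove`), then `z` lies in the lower region `A` or in the upper region `B`: the face of the
explored set owning an edge of the corner is a face around `z` (reflected, for `dualAbove`).
Contrapositive: the corners of the link strictly between `A` and `B` are unexamined —
Bollobás–Riordan's "`P'` contains bonds only in `G`". [cite: BollobasRiordan2010, §5.1 proof of Thm. 5.3] -/
theorem mem_region_of_mem_examinedCoins {S : Set (Site 2 × Fin 2)} {i : Site 2 × Fin 2}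
    (hi : i ∈ examinedCoins n s S) :
    i.1 ∈ lowerRegion n (cornerConfig S) ∨ i.1 ∈ upperRegion n s (cornerConfig S) := by
  rcases (mem_examinedCoins_iff n s).1 hi with h | h
  · left
    by_contra hA
    rw [mem_lowerRegion_iff] at hA
    push Not at hA
    exact not_mem_zone_of_forall (dualBelow_subset_lowerHull n _) hA.2 h
  · right
    by_contra hB
    rw [mem_upperRegion_iff, mem_lowerRegion_iff] at hB
    push Not at hB
    refine not_mem_zone_of_forall
      (H := (lowerHull n (reflConfig n s (cornerConfig S))).image (reflY ((n : ℤ) + s - 1)))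
      (Finset.image_subset_image (dualBelow_subset_lowerHull n _)) (fun g hg hgi => ?_) h
    obtain ⟨g₀, hg₀, rfl⟩ := Finset.mem_image.1 hgi
    have key := reflY_pred_mem_facesAt_link (c := (n : ℤ) + s) hg
    rw [reflY_reflY] at key
    exact hB.2 g₀ key hg₀

/-! ### The coins of the resampled configuration -/

/-- Membership in `brSplice`: examined coins are those of `q.1`, the others those of
`q.2.1 + q.2.2`. [folklore] -/
theorem mem_brSplice_iff (q : Set (Site 2 × Fin 2) × (Set (Site 2 × Fin 2) × Site 2))
    (i : Site 2 × Fin 2) :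
    i ∈ brSplice n s q ↔ (i ∈ q.1 ∧ i ∈ examinedCoins n s q.1) ∨
      ((i.1 - q.2.2, i.2) ∈ q.2.1 ∧ i ∉ examinedCoins n s q.1) := by
  rw [brSplice_eq, mem_splice_iff]
  have hs : (coinShift q.2.2).symm i = (i.1 - q.2.2, i.2) := by
    rw [Equiv.symm_apply_eq, coinShift_apply, sub_add_cancel]
  have key : i ∈ coinShift q.2.2 '' q.2.1 ↔ (i.1 - q.2.2, i.2) ∈ q.2.1 := by
    rw [Set.mem_image_equiv, hs]
  rw [key]

/-- Examined coins of the resampled configuration are those of `q.1`. [folklore] -/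
theorem mem_brSplice_iff_of_mem {q : Set (Site 2 × Fin 2) × (Set (Site 2 × Fin 2) × Site 2)}
    {i : Site 2 × Fin 2} (hi : i ∈ examinedCoins n s q.1) : i ∈ brSplice n s q ↔ i ∈ q.1 := by
  rw [mem_brSplice_iff]
  simp [hi]

/-- Unexamined coins of the resampled configuration are those of `q.2.1 + q.2.2`. [folklore] -/
theorem mem_brSplice_iff_of_not_mem {q : Set (Site 2 × Fin 2) × (Set (Site 2 × Fin 2) × Site 2)}
    {i : Site 2 × Fin 2} (hi : i ∉ examinedCoins n s q.1) :
    i ∈ brSplice n s q ↔ (i.1 - q.2.2, i.2) ∈ q.2.1 := by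
  rw [mem_brSplice_iff]
  simp [hi]

/-- Whether a coin is examined only depends on its corner. [folklore] -/
theorem mem_examinedCoins_iff_fst {S : Set (Site 2 × Fin 2)} {z : Site 2} (j j' : Fin 2) :
    (z, j) ∈ examinedCoins n s S ↔ (z, j') ∈ examinedCoins n s S := by
  rw [mem_examinedCoins_iff, mem_examinedCoins_iff]

/-- **The edge at an unexamined corner of the resampled configuration** is the translate of the
corresponding edge of the fresh configuration: open iff `{z - X, z - X + eᵢ}` is open in
`cornerConfig q.2.1`. [cite: BollobasRiordan2010, §5.1 proof of Thm. 5.3] -/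
theorem cornerEdge_mem_cornerConfig_brSplice_iff_of_not_mem
    (q : Set (Site 2 × Fin 2) × (Set (Site 2 × Fin 2) × Site 2)) {z : Site 2}
    (hz : ∀ j, (z, j) ∉ examinedCoins n s q.1) (i : Fin 2) :
    Literature.Probability.Percolation.cornerEdge (z, i) ∈ cornerConfig (brSplice n s q) ↔
      Literature.Probability.Percolation.cornerEdge (z - q.2.2, i) ∈ cornerConfig q.2.1 := by
  rw [cornerEdge_mem_cornerConfig_iff, cornerEdge_mem_cornerConfig_iff]
  have key : (fun j => ((z, i).1, j) ∈ brSplice n s q) = fun j => ((z - q.2.2, i).1, j) ∈ q.2.1 :=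
    funext fun j => propext (mem_brSplice_iff_of_not_mem (hz j))
  rw [key]

/-- **Both edges at an examined junction corner of the recoloured, resampled configuration are
open**: there the coins are those of the recoloured `q.1`, i.e. the imposed pattern (coin `1`,
splitting bit `0`). [cite: BollobasRiordan2010, §5.2] -/
theorem cornerEdge_mem_cornerConfig_brSplice_recolour {m : ℕ}
    (q : Set (Site 2 × Fin 2) × (Set (Site 2 × Fin 2) × Site 2)) {z : Site 2}
    (hz : (z, (0 : Fin 2)) ∈ examinedCoins n s (recolour n s m q).1)
    (hzj : z ∈ juncCorners n s m q) (i : Fin 2) :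
    Literature.Probability.Percolation.cornerEdge (z, i) ∈ cornerConfig (brSplice n s (recolour n s m q)) := by
  rw [cornerEdge_mem_cornerConfig_iff]
  have hcoins : ∀ j, (z, j) ∈ brSplice n s (recolour n s m q) ↔ j = 0 := by
    intro j
    rw [mem_brSplice_iff_of_mem ((mem_examinedCoins_iff_fst j 0).2 hz)]
    show (z, j) ∈ setOn (juncSite n s m q) ↑(juncPattern n s m q) q.1 ↔ j = 0
    have hsite : (z, j) ∈ juncSite n s m q := by
      simp only [juncSite, Finset.mem_product, Finset.mem_univ, and_true]
      exact hzj
    have hpat : (z, j) ∈ (↑(juncPattern n s m q) : Set (Site 2 × Fin 2)) ↔ j = 0 := by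
      simp only [Finset.mem_coe, juncPattern, Finset.mem_product, Finset.mem_singleton]
      exact ⟨fun h => h.2, fun h => ⟨hzj, h⟩⟩
    rw [mem_setOn_iff, hpat]
    constructor
    · rintro (⟨-, h⟩ | ⟨h, -⟩)
      · exact absurd hsite h
      · exact h
    · intro h
      exact Or.inr ⟨h, hsite⟩
  have key : (fun j => ((z, i).1, j) ∈ brSplice n s (recolour n s m q)) = fun j => j = 0 :=
    funext fun j => propext (hcoins j)
  rw [key]
  fin_cases i <;> simp

/-! ### Registered glue -/

/-- Statement form of `mem_region_of_mem_examinedCoins` — an examined corner lies in the lower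
region of `S₁` or in the upper region of `S₂`: a registered glue step the LINE POSITS and proves
right below (`linkExaminedRegion_holds`); not a literature fact, never to be relocated. -/
def LinkExaminedRegionStatement : Prop :=
  ∀ (n s : ℕ) (S : Set (Site 2 × Fin 2)) (i : Site 2 × Fin 2), i ∈ examinedCoins n s S →
    i.1 ∈ lowerRegion n (cornerConfig S) ∨ i.1 ∈ upperRegion n s (cornerConfig S)

/-- Examined corners lie in `A ∪ B`. [cite: BollobasRiordan2010, §5.1 proof of Thm. 5.3] -/
theorem linkExaminedRegion_holds : LinkExaminedRegionStatement :=
  fun _ _ _ _ hi => mem_region_of_mem_examinedCoins hi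

end Summit.CriticalPhenomena.CardyFormulaZ2.Cruxes.UniformBoxCrossing.NonSlantLine
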